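import Summits.ResolutionOfSingularities.ResolutionOfSingularities.Theorems.DescentDescentPerfectToAllFgModel
import Summits.ResolutionOfSingularities.ResolutionOfSingularities.Theorems.DescentDescentPerfectToAllRobustModel
import Literature.AlgebraicGeometry.Resolution.SmoothOfRegularPerfectField
import Literature.AlgebraicGeometry.Resolution.SmoothStalksRegular
import Mathlib.FieldTheory.IntermediateField.Adjoin.Basic
import Mathlib.FieldTheory.Perfect
import Mathlib.AlgebraicGeometry.Morphisms.Finite
import HarnessLib

/-!
# Crux `PrimeFieldToPerfect`, line `birth` (RESHAPE 3): stub `stub_climbAlgebraic`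

Route `ResolutionOfSingularities/UniversalCells`, crux `PrimeFieldToPerfect`
(stmt-ResolutionOfSingularities-15233), registered stub `stub_climbAlgebraic` of the lead's skeleton
(RESHAPE 3), PROVED here (statement verbatim from the ledger registration).

The registered open kernel of the crux (`stub_climb`, the "climb": a perfect constant field `M`
with resolution in all dimensions and a perfect `L ⊇ M` algebraic over `M(t)` ⇒ resolution over
`L`) was split by cases on `t`; this file settles the DEGENERATE case "`t` algebraic over `M`",
i.e. `L` algebraic over `M`, with the minimal true hypotheses.

**Statement.** Let `M` be a perfect field over which every integral separated scheme of finite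
type admits a resolution of singularities, and let `L` be an ALGEBRAIC extension field of `M`. Then
every integral separated `L`-scheme `X` of finite type admits a resolution.

**Proof (finite descent, then separable base change).**
1. *Spreading out* (`stub_fgModel`, EGA IV₃ 8.8.2): `X ≅ X₀ ×_{K₀} Spec L` for a subfield
   `K₀ = closure s ⊆ L` generated by a finite set `s` and a separated finite type `f₀ : X₀ → Spec K₀`.
2. `L₁ := M(s) ⊆ L` (the intermediate field generated by `s`) contains `K₀`, is FINITE over `M`
   (finitely many algebraic generators) and hence PERFECT (`Algebra.IsAlgebraic.perfectField`).
3. `X₁ := X₀ ×_{K₀} Spec L₁` is integral: `X ≅ X₁ ×_{L₁} Spec L → X₁` is flat and surjective.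
4. `X₁ → Spec L₁ → Spec M` is separated, quasi-compact and locally of finite type (the second map
   is finite), so the hypothesis over `M` gives a resolution `π : Y → X₁`.
5. `Y` is regular and locally of finite type over the perfect `L₁`, hence `Y → Spec L₁` is smooth
   (`smooth_of_isRegular_of_perfectField`); its base change `Y ×_{L₁} L → Spec L` is smooth, so
   `Y ×_{L₁} L` is regular (`isRegularLocalRing_stalk_of_smooth_of_field`).
6. `stub_resolutionOfRobustModel`: the base change of `π` to `L` is a resolution of
   `X₀ ×_{K₀} Spec L ≅ X`.

## Sources

* Q. Liu, *Algebraic Geometry and Arithmetic Curves* (2002), Prop. 3.2.7 and Cor. 4.3.33. [Liu2002]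
* A. Grothendieck, EGA IV₃ (1966), Thm. 8.8.2. [EGAIV3]
* The Stacks Project, Tags 00TV, 056S.
-/

noncomputable section

set_option linter.dupNamespace false -- mandated namespace of this single-conjunct summit

open CategoryTheory CategoryTheory.Limits AlgebraicGeometry TopologicalSpace
open Literature.AlgebraicGeometry.Resolution

namespace Summit.ResolutionOfSingularities.ResolutionOfSingularities.Theorems.PrimeFieldToPerfect

/-- **The degenerate case of the climb: algebraic extensions of a perfect field.** If every
integral separated scheme of finite type over a perfect field `M` admits a resolution of
singularities, then so does every integral separated scheme of finite type over any ALGEBRAIC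
extension field `L` of `M`. Proof: spread `X` out to `X₀ / K₀` with `K₀ ⊆ L` finitely generated,
enlarge `K₀` to the intermediate field `L₁ = M(s)`, finite over `M` hence perfect, resolve
`X₀ ×_{K₀} L₁` over `M` (it is of finite type over `M` through the finite `Spec L₁ → Spec M`), and
base change the resolution — smooth over the perfect `L₁` — along `L₁ → L`.
[cite: Liu2002, Prop. 3.2.7 and Cor. 4.3.33] -/
theorem stub_climbAlgebraic (M : Type) [Field M] [PerfectField M]
    (hM : ∀ (X : Scheme.{0}) (f : X ⟶ Spec (.of M)), IsSeparated f → LocallyOfFiniteType f →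
      QuasiCompact f → IsIntegral X → Scheme.HasResolution X)
    (L : Type) [Field L] [Algebra M L] [Algebra.IsAlgebraic M L]
    (X : Scheme.{0}) (f : X ⟶ Spec (.of L)) (hs : IsSeparated f) (hl : LocallyOfFiniteType f)
    (hq : QuasiCompact f) (hX : IsIntegral X) : Scheme.HasResolution X := by
  classical
  -- ### Step 1: spread `X` out to a model `X₀` over a finitely generated subfield `K₀ ⊆ L`
  obtain ⟨K₀, s, hK₀, X₀, f₀, hsep, hlft, hqc, -, ⟨e⟩⟩ :=
    Summit.ResolutionOfSingularities.ResolutionOfSingularities.Theorems.stub_fgModel L X f hs hl hq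
      inferInstance
  -- ### Step 2: the intermediate field `L₁ = M(s)`, finite over `M`, hence perfect
  let E : IntermediateField M L := IntermediateField.adjoin M (↑s : Set L)
  let L₁ : Subfield L := E.toSubfield
  have hL : K₀ ≤ L₁ := by
    rw [hK₀]
    exact Subfield.closure_le.2 (IntermediateField.subset_adjoin M _)
  haveI : FiniteDimensional M E :=
    IntermediateField.finiteDimensional_adjoin fun x _ =>
      (Algebra.IsAlgebraic.isAlgebraic (R := M) x).isIntegral
  haveI : Algebra.IsAlgebraic M E := Algebra.IsAlgebraic.of_finite M E
  haveI : PerfectField E := Algebra.IsAlgebraic.perfectField M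
  haveI : PerfectField L₁ := inferInstanceAs (PerfectField E)
  letI : Algebra M L₁ := E.algebra
  haveI : Module.Finite M L₁ := inferInstanceAs (Module.Finite M E)
  -- ### Step 3: `X₁ := X₀ ×_{K₀} Spec L₁` is integral, as `X ≅ X₁ ×_{L₁} Spec L → X₁` is flat
  -- and surjective
  let iL : Spec (.of L₁) ⟶ Spec (.of K₀) := Spec.map (CommRingCat.ofHom (Subfield.inclusion hL))
  let jL : Spec (.of L) ⟶ Spec (.of L₁) := Spec.map (CommRingCat.ofHom L₁.subtype)
  let XL : Scheme.{0} := pullback f₀ iL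
  let gL : XL ⟶ Spec (.of L₁) := pullback.snd f₀ iL
  have hK : L₁.subtype.comp (Subfield.inclusion hL) = K₀.subtype := RingHom.ext fun _ => rfl
  have e' : jL ≫ iL = Spec.map (CommRingCat.ofHom K₀.subtype) := by
    rw [← Spec.map_comp, ← CommRingCat.ofHom_comp, hK]
  let eK : pullback gL jL ≅ pullback f₀ (Spec.map (CommRingCat.ofHom K₀.subtype)) :=
    pullbackLeftPullbackSndIso f₀ iL jL ≪≫ pullback.congrHom rfl e'
  haveI : Flat jL := by
    rw [Flat.SpecMap_iff, CommRingCat.hom_ofHom]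
    exact RingHom.flat_algebraMap_iff.mpr (inferInstance : Module.Flat L₁ L)
  haveI : Surjective jL := by
    haveI : Subsingleton ↥(Spec (CommRingCat.of L₁)) :=
      inferInstanceAs (Subsingleton (PrimeSpectrum L₁))
    haveI : Nonempty ↥(Spec (CommRingCat.of L)) := inferInstanceAs (Nonempty (PrimeSpectrum L))
    infer_instance
  let c : X ⟶ XL := e.hom ≫ eK.inv ≫ pullback.fst gL jL
  haveI : Flat c := inferInstance
  haveI : Surjective c := inferInstance
  haveI : IsIntegral XL := by
    haveI : IsReduced XL :=
      Literature.AlgebraicGeometry.Morphisms.isReduced_of_flat_of_surjective c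
    haveI : IrreducibleSpace XL := c.surjective.irreducibleSpace c.continuous
    exact isIntegral_of_irreducibleSpace_of_isReduced XL
  -- ### Step 4: resolve `X₁` over `M` (finite type over `M` through the finite `Spec L₁ → Spec M`)
  haveI : IsSeparated gL := inferInstance
  haveI : LocallyOfFiniteType gL := inferInstance
  haveI : QuasiCompact gL := inferInstance
  let b : Spec (.of L₁) ⟶ Spec (.of M) := Spec.map (CommRingCat.ofHom (algebraMap M L₁))
  haveI : IsFinite b := by
    rw [IsFinite.SpecMap_iff, CommRingCat.hom_ofHom]
    exact RingHom.finite_algebraMap.mpr (inferInstance : Module.Finite M L₁)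
  haveI : IsSeparated (gL ≫ b) := inferInstance
  haveI : LocallyOfFiniteType (gL ≫ b) := inferInstance
  haveI : QuasiCompact (gL ≫ b) := inferInstance
  obtain ⟨Y, π, hres⟩ := hM XL (gL ≫ b) inferInstance inferInstance inferInstance inferInstance
  -- ### Step 5: `Y → Spec L₁` is smooth (regular over a perfect field), so `Y ×_{L₁} L` is regular
  haveI := hres.isProper
  haveI : Smooth (π ≫ gL) := smooth_of_isRegular_of_perfectField (π ≫ gL) hres.isRegular
  have hreg : Scheme.IsRegular (pullback (π ≫ gL) jL) := fun y =>
    isRegularLocalRing_stalk_of_smooth_of_field (pullback.snd (π ≫ gL) jL) y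
  -- ### Step 6: base change the resolution to `L` and transport along `X ≅ X₀ ×_{K₀} Spec L`
  have H :=
    Summit.ResolutionOfSingularities.ResolutionOfSingularities.Theorems.stub_resolutionOfRobustModel
      L K₀ L₁ hL X₀ f₀ hsep hlft hqc Y π hres.isProper hres.isBirational hreg
  exact H.of_iso e.inv

end Summit.ResolutionOfSingularities.ResolutionOfSingularities.Theorems.PrimeFieldToPerfect

end
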